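import Mathlib
import Literature.Computability.Complexity.LowDegreeTest
import Literature.Computability.Complexity.SumcheckField
import HarnessLib

/-!
# Low-degree extensions over a subset `H ⊆ F` (Babai–Fortnow–Levin–Szegedy), coordinatewise degree

Literature / complexity toolkit, third brick of the algebraic engine of the probabilistically
checkable proofs for exponential-time computations (after `LowDegreeTest.lean`, the
Rubinfeld–Sudan test, and `SumcheckField.lean`, the sumcheck protocol over `H ⊆ F`). The
LOW-DEGREE EXTENSION of Babai–Fortnow–Levin–Szegedy 1991, §4 (and Babai–Fortnow–Lund 1991, §4.1,
multilinear case `H = {0, 1}`): a table `Y : Hᵏ → F` extends uniquely to a polynomial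
`Ŷ : Fᵏ → F` of degree `≤ |H| - 1` in each variable,
`Ŷ(z) = ∑_{c ∈ Hᵏ} Y(c) ∏ₜ L_{cₜ}(zₜ)` with the Lagrange basis `L_a` of `H`
(Mathlib `Lagrange.basis`). This file proves:

* `CoordPoly G D` — `G : Fᵏ → F` is, in each coordinate with the others fixed, a one-variable
  polynomial function of degree `≤ D` (the hypothesis under which the sumcheck summand is sound);
  closure API (`const`, `add`, `mul`, `mono`, `finset_sum`, `proj`) and the transfer to the list
  form of `SumcheckField.lean`: reading `k` coordinates at injectively chosen positions of a
  challenge list gives `SumcheckF.AxisPoly` (`axisPoly_read`);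
* `ldeTerm`, `lde H Y` — the extension as a function, `lde_apply_of_mem` (it extends `Y` on `Hᵏ`),
  `coordPoly_lde` (degree `≤ #H - 1` in each coordinate);
* `ldePoly H Y : MvPolynomial (Fin k) F` — the same extension as a polynomial,
  `eval_ldePoly` (`= lde H Y`) and `totalDegree_ldePoly_le` (`≤ k · (#H - 1)`), the input of the
  completeness of the Rubinfeld–Sudan test (`LowDegreeTest.fwdDiff_iter_eval_eq_zero`);
* over a prime field, the bridge FROM the Rubinfeld–Sudan test: a function passing the
  finite-difference test `Δ_t^{d+1} g (x) = 0` at every `(x, t)` is `CoordPoly g d`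
  (`coordPoly_of_fwdDiff_eq_zero`, by `LowDegreeTest.exists_polynomial_of_fwdDiff_iter_eq_zero`
  along the axis `t ↦ x + s eₜ`).

## References

* L. Babai, L. Fortnow, L. Levin, M. Szegedy, *Checking computations in polylogarithmic time*,
  STOC 1991, §4 (low-degree extension over `H ⊆ F`) [BFLS1991].
* L. Babai, L. Fortnow, C. Lund, *Non-deterministic exponential time has two-prover interactive
  protocols*, Comput. Complexity 1 (1991), §4.1 (multilinear extension) [BabaiFortnowLund1991].
* S. Arora, B. Barak, *Computational Complexity: A Modern Approach*, CUP 2009, §8.6.1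
  ("low degree extension"), §11.5 [AroraBarakCC2009].
-/

noncomputable section

open Finset Polynomial

namespace Literature.Computability.Complexity

namespace LowDegreeExtension

variable {F : Type*} {k : ℕ}

/-! ### Coordinatewise low degree on `Fᵏ` -/

section Coord

variable [Field F]

/-- **Coordinatewise degree `≤ D`** for `G : Fᵏ → F`: in each coordinate, with all other coordinates
fixed, `G` is a one-variable polynomial function of degree `≤ D`. [cite: AroraBarakCC2009, §8.3.2] -/
structure CoordPoly (G : (Fin k → F) → F) (D : ℕ) : Prop where
  /-- the one-variable polynomial in coordinate `t` through the point `z` -/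
  poly : ∀ (t : Fin k) (z : Fin k → F), ∃ P : F[X], P.natDegree ≤ D ∧ ∀ a : F, G (Function.update z t a) = P.eval a

namespace CoordPoly

variable {G G' : (Fin k → F) → F} {D D' : ℕ}

/-- Constants. [folklore] -/
theorem const (D : ℕ) (c : F) : CoordPoly (fun _ : Fin k → F => c) D :=
  ⟨fun _ _ => ⟨Polynomial.C c, (natDegree_C c).le.trans (Nat.zero_le _), fun a => by simp⟩⟩

/-- Sums. [folklore] -/
theorem add (hG : CoordPoly G D) (hG' : CoordPoly G' D) : CoordPoly (fun z => G z + G' z) D := by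
  refine ⟨fun t z => ?_⟩
  obtain ⟨P, hP, hPe⟩ := hG.poly t z
  obtain ⟨Q, hQ, hQe⟩ := hG'.poly t z
  exact ⟨P + Q, (natDegree_add_le _ _).trans (max_le hP hQ), fun a => by simp only [hPe, hQe, eval_add]⟩

/-- Products (degrees add). [folklore] -/
theorem mul (hG : CoordPoly G D) (hG' : CoordPoly G' D') : CoordPoly (fun z => G z * G' z) (D + D') := by
  refine ⟨fun t z => ?_⟩
  obtain ⟨P, hP, hPe⟩ := hG.poly t z
  obtain ⟨Q, hQ, hQe⟩ := hG'.poly t z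
  exact ⟨P * Q, natDegree_mul_le.trans (Nat.add_le_add hP hQ), fun a => by simp only [hPe, hQe, eval_mul]⟩

/-- Weakening the degree. [folklore] -/
theorem mono (hG : CoordPoly G D) (h : D ≤ D') : CoordPoly G D' :=
  ⟨fun t z => by
    obtain ⟨P, hP, hPe⟩ := hG.poly t z
    exact ⟨P, hP.trans h, hPe⟩⟩

/-- Finite sums. [folklore] -/
theorem finset_sum {ι : Type*} (s : Finset ι) {Gi : ι → (Fin k → F) → F} (h : ∀ i ∈ s, CoordPoly (Gi i) D) :
    CoordPoly (fun z => ∑ i ∈ s, Gi i z) D := by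
  classical
  induction s using Finset.induction_on with
  | empty => simpa using const (k := k) D (0 : F)
  | insert a s ha ih =>
    have h' := (h a (mem_insert_self a s)).add (ih fun i hi => h i (mem_insert_of_mem hi))
    simpa [sum_insert ha] using h'

/-- A one-variable polynomial read at one coordinate. [folklore] -/
theorem proj (D : ℕ) {P : F[X]} (hP : P.natDegree ≤ D) (t₀ : Fin k) :
    CoordPoly (fun z : Fin k → F => P.eval (z t₀)) D := by
  refine ⟨fun t z => ?_⟩
  by_cases h : t = t₀
  · subst h
    exact ⟨P, hP, fun a => by simp⟩
  · exact ⟨Polynomial.C (P.eval (z t₀)), (natDegree_C _).le.trans (Nat.zero_le _), fun a => by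
      simp [Function.update_of_ne (Ne.symm h)]⟩

/-- Finite products of one-variable polynomials read at the coordinates: `∏ₜ Pₜ(zₜ)` is
coordinatewise of degree `≤ maxₜ deg Pₜ ≤ D`. [folklore] -/
theorem prod_proj (D : ℕ) {P : Fin k → F[X]} (hP : ∀ t, (P t).natDegree ≤ D) :
    CoordPoly (fun z : Fin k → F => ∏ t, (P t).eval (z t)) D := by
  refine ⟨fun t z => ?_⟩
  refine ⟨Polynomial.C (∏ s ∈ univ.erase t, (P s).eval (z s)) * P t,
    (natDegree_C_mul_le _ _).trans (hP t), fun a => ?_⟩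
  rw [← Finset.mul_prod_erase univ _ (mem_univ t), eval_mul, eval_C, Function.update_self, mul_comm]
  congr 1
  exact prod_congr rfl fun s hs => by rw [Function.update_of_ne (ne_of_mem_erase hs)]

end CoordPoly

end Coord

/-! ### From `Fᵏ` to challenge lists: reading coordinates at fixed positions -/

section Read

/-- Reading a list before the inserted position. [folklore] -/
theorem getD_append_cons_of_lt {pref suff : List F} {a d : F} {q : ℕ} (h : q < pref.length) :
    (pref ++ a :: suff).getD q d = pref.getD q d := by
  rw [List.getD_eq_getElem?_getD, List.getD_eq_getElem?_getD, List.getElem?_append_left h]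

/-- Reading a list at the inserted position. [folklore] -/
theorem getD_append_cons_self (pref suff : List F) (a d : F) :
    (pref ++ a :: suff).getD pref.length d = a := by
  rw [List.getD_eq_getElem?_getD, List.getElem?_append_right le_rfl, Nat.sub_self]
  rfl

/-- Reading a list after the inserted position. [folklore] -/
theorem getD_append_cons_of_gt {pref suff : List F} {a d : F} {q : ℕ} (h : pref.length < q) :
    (pref ++ a :: suff).getD q d = suff.getD (q - pref.length - 1) d := by
  rw [List.getD_eq_getElem?_getD, List.getD_eq_getElem?_getD, List.getElem?_append_right h.le]
  obtain ⟨u, hu⟩ : ∃ u, q - pref.length = u + 1 := ⟨q - pref.length - 1, by omega⟩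
  rw [hu, List.getElem?_cons_succ, Nat.add_sub_cancel]

/-- Off the inserted position the reading does not depend on the inserted element. [folklore] -/
theorem getD_append_cons_of_ne {pref suff : List F} (a a' : F) {d : F} {q : ℕ} (h : q ≠ pref.length) :
    (pref ++ a :: suff).getD q d = (pref ++ a' :: suff).getD q d := by
  rcases lt_or_gt_of_ne h with hq | hq
  · rw [getD_append_cons_of_lt hq, getD_append_cons_of_lt hq]
  · rw [getD_append_cons_of_gt hq, getD_append_cons_of_gt hq]

/-- **Transfer to the list form of the sumcheck**: if `G : Fᵏ → F` is coordinatewise of degree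
`≤ D`, then reading its `k` arguments at injectively chosen positions `idx t` of a challenge list
gives a summand that is `AxisPoly` in the sense of `SumcheckField.lean` (in the coordinate at an
unread position it is constant; at the position `idx t₀` it is `G` along the axis `t₀`).
[cite: AroraBarakCC2009, §8.3.2] -/
theorem axisPoly_read [Field F] {G : (Fin k → F) → F} {D : ℕ} (hG : CoordPoly G D) {idx : Fin k → ℕ}
    (hidx : Function.Injective idx) (K : ℕ) :
    SumcheckF.AxisPoly (fun l : List F => G fun t => l.getD (idx t) 0) K D := by
  classical
  refine ⟨fun pref suff _ => ?_⟩
  by_cases hex : ∃ t₀, idx t₀ = pref.length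
  · obtain ⟨t₀, ht₀⟩ := hex
    -- along the axis `t₀` through the point read with `a = 0`
    set z : Fin k → F := fun t => (pref ++ (0 : F) :: suff).getD (idx t) 0 with hz
    obtain ⟨P, hP, hPe⟩ := hG.poly t₀ z
    refine ⟨P, hP, fun a => ?_⟩
    rw [← hPe a]
    congr 1
    funext t
    by_cases ht : t = t₀
    · subst ht
      rw [Function.update_self, ht₀, getD_append_cons_self]
    · rw [Function.update_of_ne ht, hz]
      exact getD_append_cons_of_ne a 0 fun h => ht (hidx (h.trans ht₀.symm))
  · simp only [not_exists] at hex
    refine ⟨Polynomial.C (G fun t => (pref ++ (0 : F) :: suff).getD (idx t) 0),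
      (natDegree_C _).le.trans (Nat.zero_le _), fun a => ?_⟩
    rw [eval_C]
    congr 1
    funext t
    exact getD_append_cons_of_ne a 0 (hex t)

end Read

/-! ### The low-degree extension -/

section LDE

variable [Field F] [DecidableEq F] (H : Finset F)

/-- One term of the extension: `Y(c) ∏ₜ L_{cₜ}(zₜ)` for a node `c ∈ Hᵏ` (`L_a` the Lagrange basis
polynomial of `H` at `a`). [cite: BFLS1991, §4] -/
def ldeTerm (Y : (Fin k → F) → F) (c : Fin k → H) (z : Fin k → F) : F :=
  Y (fun t => (c t : F)) * ∏ t, (Lagrange.basis H id (c t : F)).eval (z t)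

/-- **The low-degree extension** of the table `Y` on `Hᵏ`:
`Ŷ(z) = ∑_{c ∈ Hᵏ} Y(c) ∏ₜ L_{cₜ}(zₜ)`. [cite: BFLS1991, §4] -/
def lde (Y : (Fin k → F) → F) (z : Fin k → F) : F := ∑ c : Fin k → H, ldeTerm H Y c z

variable {H}

/-- The Lagrange basis of `H` is a delta function on `H`. [Mathlib `Lagrange.eval_basis_self`,
`eval_basis_of_ne`] [folklore] -/
theorem eval_basis_mem {a b : F} (ha : a ∈ H) (hb : b ∈ H) :
    (Lagrange.basis H id a).eval b = if a = b then 1 else 0 := by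
  split_ifs with h
  · subst h
    exact Lagrange.eval_basis_self (v := id) (fun _ _ _ _ h => h) ha
  · exact Lagrange.eval_basis_of_ne (v := id) h hb

/-- A term of the extension at a node of `Hᵏ` is `Y(c)` at `c` and `0` elsewhere. [folklore] -/
theorem ldeTerm_apply_of_mem (Y : (Fin k → F) → F) (c : Fin k → H) {z : Fin k → F} (hz : ∀ t, z t ∈ H) :
    ldeTerm H Y c z = if (fun t => (c t : F)) = z then Y z else 0 := by
  classical
  unfold ldeTerm
  split_ifs with h
  · rw [← h]
    have : ∏ t, (Lagrange.basis H id (c t : F)).eval (c t : F) = 1 :=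
      prod_eq_one fun t _ => by rw [eval_basis_mem (c t).2 (c t).2, if_pos rfl]
    rw [this, mul_one]
  · obtain ⟨t, ht⟩ : ∃ t, (c t : F) ≠ z t := by
      by_contra hall
      exact h (funext fun t => not_not.mp (not_exists.mp hall t))
    rw [prod_eq_zero (mem_univ t) (by rw [eval_basis_mem (c t).2 (hz t), if_neg ht]), mul_zero]

/-- **The extension extends**: `Ŷ(z) = Y(z)` for `z ∈ Hᵏ`. [cite: BFLS1991, §4] -/
theorem lde_apply_of_mem (Y : (Fin k → F) → F) {z : Fin k → F} (hz : ∀ t, z t ∈ H) : lde H Y z = Y z := by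
  classical
  unfold lde
  rw [sum_eq_single (fun t => ⟨z t, hz t⟩)]
  · rw [ldeTerm_apply_of_mem Y _ hz, if_pos rfl]
  · intro c _ hc
    rw [ldeTerm_apply_of_mem Y c hz, if_neg]
    intro h
    apply hc
    funext t
    exact Subtype.ext (congrFun h t)
  · intro h
    exact absurd (mem_univ _) h

/-- **The extension has degree `≤ #H - 1` in each coordinate.** [cite: BFLS1991, §4] -/
theorem coordPoly_lde (Y : (Fin k → F) → F) : CoordPoly (lde H Y) (H.card - 1) := by
  unfold lde ldeTerm
  refine CoordPoly.finset_sum _ fun c _ => ?_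
  have h := (CoordPoly.const (k := k) 0 (Y fun t => (c t : F))).mul
    (CoordPoly.prod_proj (H.card - 1) (P := fun t => Lagrange.basis H id (c t : F)) fun t => ?_)
  · simpa using h
  · rw [Lagrange.natDegree_basis (v := id) (fun _ _ _ _ h => h) (c t).2]

/-! ### The extension as a polynomial: total degree -/

omit [DecidableEq F] in
/-- Total degree of a one-variable polynomial placed in variable `i`. [folklore] -/
theorem totalDegree_toMvPolynomial_le (P : F[X]) (i : Fin k) :
    (P.toMvPolynomial i).totalDegree ≤ P.natDegree := by
  rw [Polynomial.toMvPolynomial, Polynomial.aeval_eq_sum_range]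
  refine (MvPolynomial.totalDegree_finsetSum _ _).trans (Finset.sup_le fun n hn => ?_)
  refine (MvPolynomial.totalDegree_smul_le _ _).trans ((MvPolynomial.totalDegree_X_pow _ _).le.trans ?_)
  exact Nat.lt_succ_iff.mp (Finset.mem_range.mp hn)

variable (H) in
/-- **The extension as a polynomial** in `k` variables:
`∑_{c ∈ Hᵏ} C(Y c) · ∏ₜ L_{cₜ}(Xₜ)`. [cite: BFLS1991, §4] -/
def ldePoly (Y : (Fin k → F) → F) : MvPolynomial (Fin k) F :=
  ∑ c : Fin k → H, MvPolynomial.C (Y fun t => (c t : F)) * ∏ t, (Lagrange.basis H id (c t : F)).toMvPolynomial t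

/-- Evaluating the extension polynomial gives the extension. [folklore] -/
theorem eval_ldePoly (Y : (Fin k → F) → F) (z : Fin k → F) : MvPolynomial.eval z (ldePoly H Y) = lde H Y z := by
  unfold ldePoly lde ldeTerm
  rw [map_sum]
  refine sum_congr rfl fun c _ => ?_
  rw [map_mul, MvPolynomial.eval_C, map_prod]
  exact congrArg _ (prod_congr rfl fun t _ => MvPolynomial.eval_toMvPolynomial z t _)

/-- **Total degree of the extension**: `≤ k · (#H - 1)`. [cite: BFLS1991, §4] -/
theorem totalDegree_ldePoly_le (Y : (Fin k → F) → F) : (ldePoly H Y).totalDegree ≤ k * (H.card - 1) := by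
  unfold ldePoly
  refine (MvPolynomial.totalDegree_finsetSum _ _).trans (Finset.sup_le fun c _ => ?_)
  refine (MvPolynomial.totalDegree_mul _ _).trans ?_
  rw [MvPolynomial.totalDegree_C, zero_add]
  refine (MvPolynomial.totalDegree_finsetProd _ _).trans ?_
  calc ∑ t, ((Lagrange.basis H id (c t : F)).toMvPolynomial t).totalDegree
      ≤ ∑ _t : Fin k, (H.card - 1) := sum_le_sum fun t _ =>
        (totalDegree_toMvPolynomial_le _ _).trans
          (le_of_eq (Lagrange.natDegree_basis (v := id) (fun _ _ _ _ h => h) (c t).2))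
    _ = k * (H.card - 1) := by rw [sum_const, card_univ, Fintype.card_fin, smul_eq_mul]

/-- **Completeness of the Rubinfeld–Sudan test for the extension**: with `d ≥ k (#H - 1)` the
extension passes the finite-difference test at every `(x, t)`.
[cite: RubinfeldSudan1996, §4] [cite: BFLS1991, §4] -/
theorem fwdDiff_iter_lde_eq_zero (Y : (Fin k → F) → F) {d : ℕ} (hd : k * (H.card - 1) ≤ d)
    (x t : Fin k → F) : (fwdDiff t)^[d + 1] (lde H Y) x = 0 := by
  have h := LowDegreeTest.fwdDiff_iter_eval_eq_zero (ldePoly H Y) ((totalDegree_ldePoly_le Y).trans hd) x t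
  have hfun : (fun y => MvPolynomial.eval y (ldePoly H Y)) = lde H Y := funext (eval_ldePoly Y)
  rw [hfun] at h
  exact h

end LDE

/-! ### From the finite-difference test to coordinatewise low degree (prime fields) -/

/-- Along an axis, translation by the coordinate vector is an update. [folklore] -/
theorem update_add_single [Field F] (z : Fin k → F) (t : Fin k) (s i : F) :
    Function.update z t s + i • (Pi.single t 1 : Fin k → F) = Function.update z t (s + i) := by
  funext u
  by_cases hu : u = t
  · subst hu
    simp
  · simp [Function.update_of_ne hu, Pi.single_eq_of_ne hu]

/-- **A function passing the degree-`d` finite-difference test everywhere is coordinatewise of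
degree `≤ d`** (over `ZMod p`): along the axis `t` through `z` the one-variable function
`s ↦ g(z[t ↦ s])` satisfies `Δ_1^{d+1} = 0`, hence is a polynomial function of degree `≤ d`
(`LowDegreeTest.exists_polynomial_of_fwdDiff_iter_eq_zero`). [cite: RubinfeldSudan1996, §4] -/
theorem coordPoly_of_fwdDiff_eq_zero {p : ℕ} [Fact p.Prime] {d : ℕ} (g : (Fin k → ZMod p) → ZMod p)
    (hg : ∀ x t : Fin k → ZMod p, (fwdDiff t)^[d + 1] g x = 0) : CoordPoly g d := by
  classical
  refine ⟨fun t z => ?_⟩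
  set u : ZMod p → ZMod p := fun s => g (Function.update z t s) with hu
  have hΔ : ∀ (n : ℕ) (s : ZMod p),
      (fwdDiff (1 : ZMod p))^[n] u s = (fwdDiff (Pi.single t 1 : Fin k → ZMod p))^[n] g (Function.update z t s) := by
    intro n s
    rw [fwdDiff_iter_eq_sum_shift, fwdDiff_iter_eq_sum_shift]
    refine sum_congr rfl fun i _ => ?_
    congr 1
    rw [hu]
    simp only
    rw [nsmul_eq_mul, mul_one, ← update_add_single z t s (i : ZMod p), Nat.cast_smul_eq_nsmul]
  have hzero : (fwdDiff (1 : ZMod p))^[d + 1] u = 0 := by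
    funext s
    rw [hΔ, hg]
    rfl
  obtain ⟨P, hP, hPe⟩ := LowDegreeTest.exists_polynomial_of_fwdDiff_iter_eq_zero u hzero
  exact ⟨P, hP, fun a => hPe a⟩

end LowDegreeExtension

end Literature.Computability.Complexity

end
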